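import Summits.Langlands.Langlands.Statement
import Literature.NumberTheory.Automorphic.ACCAutomorphyLiftingCrystalline
import Literature.NumberTheory.Automorphic.PolarizedCompatibleSystemRationalModelsProofs
import HarnessLib

/-!
# Floor witness (F3) for the rung `CrystallineLiftingCM 2` of line `CrystallineLiftingCMAllWeights`
# (crux `ReciprocityUpToIrreducibility`, item stmt-Langlands-14328; G4 ladder-down, generation 9)

`floor_zero : ACCGHLNSTT2023.automorphyLifting_crystalline_weightZero → CrystallineLiftingCM 0` — the
floor `θ = 0` of the dial IS the ten-author theorem ACC+ Thm 6.1.1 at weight zero, the tree's named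
Literature fact (`Literature/NumberTheory/Automorphic/ACCAutomorphyLiftingCrystalline.lean`), whose
binder list the family copies VERBATIM (plus the harmless extra binders `0 < n`, `ρ` irreducible, and
`θ ≤ 2 →` guards that discharge by `norm_num` at `θ = 0`): the fact's conclusion `HLTT.IsCompatible Pi ι ρ`
with `Pi` of weight zero gives the family's conclusion with `m = n` — a.e. Satake–Frobenius matching by
`eventually_isGaloisCompatibleAt_of_isCompatible` (HLTT-compatibility leaves out finitely many places)
and Flath (`hasSatakeParamAt_cofinite_holds`), and `weightZero ⊗ |det|^{(1-n)/2}` is L-algebraic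
(`isLAlgebraic_twist_weightZero`: exponents `-i`, `i + 1 - n`).  The family is VERBATIM the one of
`Lines/CrystallineLiftingCMAllWeights.lean`.  Sorry-free; standard axioms; the only non-theorem input is
the named fact, taken as a hypothesis (exactly as g2–g8's `floor_k : named_fact → E k`).
-/

noncomputable section

set_option linter.dupNamespace false

open scoped MatrixGroups Matrix NumberField Classical
open NumberField IsDedekindDomain Field Filter
open Literature.NumberTheory.Automorphic Literature.NumberTheory.GaloisRepresentations
open Literature.NumberTheory.PAdicHodge
open Summit.Langlands

namespace Summit.Langlands.Langlands.Cruxes.ReciprocityUpToIrreducibility.CrystallineLiftingCMAllWeights.Special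

/-- The **labelled Hodge–Tate weight clause** of the dial, at one label: `θ = 0` — the weights are
`{0, 1, …, n-1}` (weight zero, ACC+ Thm 6.1.1 as formalised); `θ = 1` — pairwise distinct and inside
the (per-label halved) Fontaine–Laffaille window `2 (a - b) < p - 2` (implies ACC+ (5a)
`λ_{τ,1} + λ_{τc,1} - λ_{τ,n} - λ_{τc,n} < p - 2n`); `θ ≥ 2` — pairwise distinct, NO bound. -/
def htClause (n p : ℕ) (w : Multiset ℤ) : ℕ → Prop
  | 0 => w = (Multiset.range n).map fun i : ℕ => (i : ℤ)
  | 1 => w.Nodup ∧ ∀ a ∈ w, ∀ b ∈ w, 2 * (a - b) < (p : ℤ) - 2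
  | _ + 2 => w.Nodup

/-- The **local clause at `v ∣ p`** of the dial: `θ ≤ 2` — crystalline; `θ ≥ 3` — de Rham
(potentially semistable), for the PINNED Fontaine datum. -/
def localClause {K : Type} [Field K] [NumberField K] {p : ℕ} [Fact p.Prime] {n : ℕ}
    (v : HeightOneSpectrum (𝓞 K)) (hv : ((p : ℕ) : 𝓞 K) ∈ v.asIdeal)
    (ρv : FramedRep (absoluteGaloisGroup (v.adicCompletion K)) (PadicAlgCl p) n) (θ : ℕ) : Prop :=
  if θ ≤ 2 then (fontainePstAdicCompletion v p hv).IsCrystallineFramed ρv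
  else (fontainePstAdicCompletion v p hv).IsDeRhamFramed ρv

/-- The **automorphic seed clause** of the dial: the residually-automorphic seed `π` has the weight of
`ρ`: `θ = 0` — `π` has weight zero (ACC+ verbatim); `θ ≥ 1` — `π` has a regular algebraic infinity
type `T` whose recipe `HT_σ(r_ι(π)) = hodgeTateWeights (T ⊗ |det|^{(1-n)/2}) σ` (Buzzard–Gee; cyclotomic
weight `-1`) reproduces the labelled Hodge–Tate weights of `ρ` at every `v ∣ p` and every label. -/
def seedClause {F : Type} [Field F] [NumberField F] {n : ℕ}
    {hcpt : isCompact_glFiniteIntegralLevel n F} {p : ℕ} [Fact p.Prime]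
    (ι : PadicAlgCl p ≃+* ℂ) (ρ : FramedGaloisRep F (PadicAlgCl p) n)
    (π : CuspidalAutomorphicRepData n F hcpt) : ℕ → Prop
  | 0 => π.1.HasWeightZero
  | _ + 1 => ∃ T : InfinityType F n, π.1.HasInfinityType T ∧ T.IsRegularAlgebraic ∧
      ∀ (v : HeightOneSpectrum (𝓞 F)) (hv : ((p : ℕ) : 𝓞 F) ∈ v.asIdeal),
        let D := fontainePstAdicCompletion v p hv
        letI := D.algebra
        ∀ τ' : v.adicCompletion F →ₐ[ℚ_[p]] PadicAlgCl p,
          (ρ.labelledHodgeTateWeightsAt v D.algebra D.𝔅 τ'.toRingHom).map (fun k : ℤ => (k : ℂ)) =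
            (T.twist ((1 - (n : ℂ)) / 2)).hodgeTateWeights
              (ι.toRingHom.comp (τ'.toRingHom.comp (algebraMap F (v.adicCompletion F))))

/-- **The rung family** `E(θ)` (dial = p-adic-Hodge depth of the weight/local condition at `ℓ = p` in
the Calegari–Geraghty automorphy lifting theorem for `GL_n` over an imaginary CM field, ACC+ Thm 6.1.1):
for `F` imaginary CM, `p > n²`, `p > 2n` unramified in `F` (for `θ ≤ 2`), `ρ : Γ_F → GL_n(ℚ̄_p)`
irreducible, unramified a.e., satisfying the local clause `localClause θ` and the labelled-weight clause
`htClause θ` at every `v ∣ p`, with residual representation `τ = ρ̄` absolutely irreducible, decomposed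
generic, `ρ̄|Γ_{F(ζ_p)}` absolutely irreducible with enormous image and a scalar `ρ̄(σ)`, `σ ∉ Γ_{F(ζ_p)}`,
and RESIDUALLY AUTOMORPHIC of the same weight: a cuspidal `π` (unramified above `p` when `θ ≤ 2`) with
`seedClause θ` and an HLTT-compatible `r ≡ ρ (mod 𝔪)` — conclusion: `ρ` is automorphic up to the
normalisation twist, i.e. there are a cuspidal `Π` of `GL_n(𝔸_F)` and `m : ℕ` with `Π ⊗ |det|^{(1-m)/2}`
L-algebraic and `char(ρ(Frob_v)) = arithFrobPolyOfSatake ι q_v m (Satake(Π_v))` at almost every `v`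
(`m = n`: `ρ ≅ r_ι(Π)`; `m = 1`: the summit's `SatakeFrobCompatibleAt`).  `θ = 0`: weight zero —
ACC+ Thm 6.1.1 (the tree's named fact); `θ = 1`: Fontaine–Laffaille weights — ACC+ Thm 6.1.1 for
general `λ` (print); `θ = 2`: ALL regular weights, crystalline, `p` unramified — OPEN (the rung);
`θ ≥ 3`: de Rham at `p`, any ramification — OPEN.
[cite: AllenEtAl2023, Thm. 6.1.1] [cite: CaraianiNewton2023, Thm. 4.2.15 and Rem. 5.2.3] -/
def CrystallineLiftingCM (θ : ℕ) : Prop :=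
  ∀ (F : Type) [Field F] [NumberField F], IsCMField F →
    ∀ (n : ℕ) (hcpt : isCompact_glFiniteIntegralLevel n F) (p : ℕ) [Fact p.Prime],
      0 < n → n ^ 2 < p → 2 * n < p →
      (θ ≤ 2 → Algebra.IsUnramifiedIn (𝓞 F) (Ideal.span {(p : ℤ)})) →
    ∀ (ι : PadicAlgCl p ≃+* ℂ) (ρ : FramedGaloisRep F (PadicAlgCl p) n)
      (τ : absoluteGaloisGroup F →* GL (Fin n) (padicAlgClResidueField p))
      (π : CuspidalAutomorphicRepData n F hcpt) (r : FramedGaloisRep F (PadicAlgCl p) n),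
      ρ.toGaloisRep.IsIrreducible →
      (∀ᶠ v : HeightOneSpectrum (𝓞 F) in cofinite, ρ.IsUnramifiedAt v) →
      (∀ (v : HeightOneSpectrum (𝓞 F)) (hv : ((p : ℕ) : 𝓞 F) ∈ v.asIdeal),
        localClause v hv (ρ.toLocal v) θ ∧
          (let D := fontainePstAdicCompletion v p hv
           letI := D.algebra
           ∀ τ' : v.adicCompletion F →ₐ[ℚ_[p]] PadicAlgCl p,
             htClause n p (ρ.labelledHodgeTateWeightsAt v D.algebra D.𝔅 τ'.toRingHom) θ)) →
      ρ.IsResidualRepOf (RingHom.id _) τ → IsAbsIrreducible τ → IsDecomposedGeneric τ →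
      IsAbsIrreducible (τ.comp (absGaloisGroupAdjoinRootsOfUnity F p).subtype) →
      Subgroup.IsEnormous ((absGaloisGroupAdjoinRootsOfUnity F p).map τ) →
      (∃ σ : absoluteGaloisGroup F, σ ∉ absGaloisGroupAdjoinRootsOfUnity F p ∧
        ∃ c : padicAlgClResidueField p,
          ((τ σ : GL (Fin n) (padicAlgClResidueField p)) :
            Matrix (Fin n) (Fin n) (padicAlgClResidueField p)) = c • (1 : Matrix _ _ _)) →
      seedClause ι ρ π θ → HLTT.IsCompatible π.1 ι r → r.IsResidualRepOf (RingHom.id _) τ →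
      (θ ≤ 2 → ∀ v : HeightOneSpectrum (𝓞 F), ((p : ℕ) : 𝓞 F) ∈ v.asIdeal → π.1.IsUnramifiedAt v) →
      ∃ (Pi : CuspidalAutomorphicRepData n F hcpt) (m : ℕ),
        (∃ T : InfinityType F n, Pi.1.HasInfinityType T ∧
          (T.twist ((1 - (m : ℂ)) / 2)).IsLAlgebraic) ∧
        ∀ᶠ v : HeightOneSpectrum (𝓞 F) in cofinite, ∃ α : Multiset ℂ,
          Pi.1.HasSatakeParamAt v α ∧ ρ.IsUnramifiedAt v ∧
            ρ.HasFrobCharpolyAt v (arithFrobPolyOfSatake ι v.residueCard m α)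

/-- **THE RUNG** (the filed statement): the family at `θ = 2` — Calegari–Geraghty automorphy lifting
for `GL_n` over imaginary CM fields in ALL regular crystalline weights (`p` unramified, `p > n²`), i.e.
ACC+ Thm 6.1.1 with the Fontaine–Laffaille weight bound (5a) removed. -/
def CrystallineLiftingCMAllWeights : Prop := CrystallineLiftingCM 2

/-! ## Floor: `θ = 0` is ACC+ Thm 6.1.1 (the tree's named fact) -/

/-- The weight-zero infinity type twisted by `|det|^{(1-n)/2}` is L-algebraic
(`ρ_i + (1-n)/2 = -i`, `-ρ_i + (1-n)/2 = i + 1 - n`). -/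
theorem isLAlgebraic_twist_weightZero (n : ℕ) (F : Type) [Field F] :
    ((weightZeroInfinityType n F).twist ((1 - (n : ℂ)) / 2)).IsLAlgebraic := by
  intro σ q hq
  simp only [InfinityType.twist_apply, weightZeroInfinityType_apply, Multiset.map_map,
    Function.comp_def, Multiset.mem_map, Finset.mem_val, Finset.mem_univ, true_and] at hq
  obtain ⟨i, rfl⟩ := hq
  refine ⟨-((i : ℕ) : ℤ), ((i : ℕ) : ℤ) + 1 - n, ?_, ?_⟩
  · simp [rhoGL]; ring
  · simp [rhoGL]; ring

/-- **FLOOR** `θ = 0` from the named fact ACC+ Thm 6.1.1 (weight zero): `m = n`, `Π` of weight zero;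
a.e. Satake matching from HLTT-compatibility (`eventually_isGaloisCompatibleAt_of_isCompatible`) and
Flath (`hasSatakeParamAt_cofinite_holds`). -/
theorem floor_zero (hACC : ACCGHLNSTT2023.automorphyLifting_crystalline_weightZero) :
    CrystallineLiftingCM 0 := by
  intro F _ _ hCM n hcpt p _ hn hn2 h2n hunrp ι ρ τ π r hirr hunr hloc hres hτ hdg hζ henorm hσ
    hseed hcomp hresr hπp
  have hloc' : ∀ (v : HeightOneSpectrum (𝓞 F)) (hv : ((p : ℕ) : 𝓞 F) ∈ v.asIdeal),
      let D := fontainePstAdicCompletion v p hv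
      D.IsCrystallineFramed (ρ.toLocal v) ∧
        (letI := D.algebra
         ∀ τ' : v.adicCompletion F →ₐ[ℚ_[p]] PadicAlgCl p,
           ρ.labelledHodgeTateWeightsAt v D.algebra D.𝔅 τ'.toRingHom =
             (Multiset.range n).map fun i : ℕ => (i : ℤ)) := by
    intro v hv
    obtain ⟨h1, h2⟩ := hloc v hv
    exact ⟨by simpa [localClause] using h1, fun τ' => h2 τ'⟩
  obtain ⟨Pi, hPi0, hc, -, -⟩ := hACC F (Or.inr hCM) n hcpt p hn2 h2n (hunrp (by norm_num)) ι ρ τ π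
    r hunr hloc' hres hτ hdg hζ henorm hσ hseed hcomp hresr (hπp (by norm_num))
  refine ⟨Pi, n, ⟨weightZeroInfinityType n F, hPi0, isLAlgebraic_twist_weightZero n F⟩, ?_⟩
  have hae := eventually_isGaloisCompatibleAt_of_isCompatible Pi (ι := ι) (r := ρ) hc
  have hcof : ∀ᶠ v : HeightOneSpectrum (𝓞 F) in cofinite, ∃ α : Multiset ℂ,
      Pi.1.HasSatakeParamAt v α := Pi.1.hasSatakeParamAt_cofinite_holds
  filter_upwards [hae, hcof] with v h1 ⟨α, hα⟩
  exact ⟨α, hα, (h1 α hα).1, (h1 α hα).2⟩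

end Summit.Langlands.Langlands.Cruxes.ReciprocityUpToIrreducibility.CrystallineLiftingCMAllWeights.Special

end
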